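import Literature.IUT.HodgeTheaters.InitialThetaData
import Literature.NumberTheory.EllipticCurves.GaloisActionProofs
import Literature.NumberTheory.GaloisRepresentations.ArtinRestriction
import HarnessLib

/-!
# [IUTchI] Def. 3.1 (c): the field `K := F(E_F[l])` as the fixed field of `Ker(ρ̄_{E,l})` — adapters

`Proofs` file (theorems only; no definitions, no named facts, no instances) by the cell `abc-iut`
(seat abc-iut-L5-t12; support for abc-iut-L5-t7's (P7)-ARITHMETIC constructor of initial Θ-data
from a `λ`-line point, [IUTchIV] Cor. 2.2 (ii) p. 46). S. Mochizuki, *Inter-universal Teichmüller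
theory I*, Def. 3.1 (c) (kurims May-2020 manuscript p. 62): "`K ⊆ F̄` … the finite Galois extension
of `F` determined by the kernel of this homomorphism [`G_F → GL₂(𝔽_l)`]". In the tree's typing
(`InitialThetaData F K Fbar E l P`, abc-iut-L5-t2) `K` is an abstract number field with
`F → K → F̄` and the clause is the field `range_K_iff : ∀ x : F̄, x ∈ range (K → F̄) ↔ ∀ σ ∈ G_F,
FixesTorsion E l σ → σ x = x`. When `F̄ := AlgebraicClosure F` the canonical choice is
`K := (Ker ρ̄_{E,l})`-fixed subfield of `F̄` (`IntermediateField.fixedField`, with the tree's mod-`l`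
representation `WeierstrassCurve.galoisRepTorsion`); this file records, for that choice:

* `fixesTorsion_iff_mem_ker` — `FixesTorsion E l σ ↔ σ ∈ Ker(ρ̄_{E,l})` (the two typings of "acts
  trivially on `E[l](F̄)`": L5's `galoisAct`/`FixesTorsion` and the `GaloisAction` module's
  `galoisRepTorsion`);
* `range_algebraMap_fixedField_ker_iff` — the clause `range_K_iff` of Def. 3.1 (c) HOLDS for
  `K := fixedField (Ker ρ̄_{E,l})`;
* `finiteDimensional_fixedField_ker`, `numberField_fixedField_ker`, `isGalois_fixedField_ker` —
  "`K` … the finite Galois extension of `F`": `K/F` is finite (the kernel is open,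
  `isOpen_ker_galoisRepTorsion_holds`; `finiteDimensional_fixedField_of_isOpen`), `K` is a number
  field, and `K/F` is Galois (the kernel is normal).

Classical (Silverman *AEC* III.§7, VIII.§1; Serre 1972 §4.1); nothing of the series is asserted; no
side is taken on [IUTchIII] Cor. 3.12.

## References

* [Mochizuki2012] S. Mochizuki, IUT I, Def. 3.1 (c) p. 62; IUT IV, Cor. 2.2 (ii) p. 46.
* [Serre1972] J.-P. Serre, Invent. Math. 15 (1972), §4.1.
* [SilvermanAEC2009] J. H. Silverman, *The Arithmetic of Elliptic Curves*, 2nd ed., III.§7, VIII.§1.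
-/

noncomputable section

open scoped Classical

namespace Literature.IUT.HodgeTheaters

open WeierstrassCurve Literature.NumberTheory.EllipticCurves Literature.NumberTheory.GaloisRepresentations

section TorsionField

variable {F : Type} [Field F] [NumberField F] (E : WeierstrassCurve F) [E.IsElliptic] (l : ℕ)

omit [NumberField F] [E.IsElliptic] in
/-- **`FixesTorsion E l σ ↔ σ ∈ Ker(ρ̄_{E,l})`** (`F̄ = AlgebraicClosure F`): L5's "σ acts trivially
on `E_F[l](F̄)`" ([IUTchI] Def. 3.1 (c), via `galoisAct = Point.map σ`) is membership in the kernel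
of the tree's mod-`l` representation `galoisRepTorsion` (`coe_ker_galoisRepTorsion`: the kernel is
the pointwise stabiliser of `E[l]`). [claim: Mochizuki2012, status: disputed] -/
theorem fixesTorsion_iff_mem_ker (σ : Field.absoluteGaloisGroup F) :
    FixesTorsion (Fbar := AlgebraicClosure F) E l σ ↔ σ ∈ (E.galoisRepTorsion (l : ℤ)).ker := by
  rw [← SetLike.mem_coe, coe_ker_galoisRepTorsion, Set.mem_iInter]
  constructor
  · intro h P
    rw [SetLike.mem_coe, MulAction.mem_stabilizer_iff]
    exact h (P : geomPoints E) ((Submodule.mem_torsionBy_iff (l : ℤ) (P : geomPoints E)).mp P.2)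
  · intro h P hP
    have hPm : (P : geomPoints E) ∈ E.geomTorsion (l : ℤ) :=
      (Submodule.mem_torsionBy_iff (l : ℤ) (P : geomPoints E)).mpr hP
    have := h ⟨P, hPm⟩
    rw [SetLike.mem_coe, MulAction.mem_stabilizer_iff] at this
    exact this

omit [NumberField F] [E.IsElliptic] in
/-- **Def. 3.1 (c) `range_K_iff` for the canonical `K := F̄^{Ker ρ̄_{E,l}}`:** an element of
`F̄ = AlgebraicClosure F` lies in (the image of) the fixed field of `Ker(ρ̄_{E,l})` iff it is fixed by
every `σ ∈ G_F` acting trivially on `E_F[l](F̄)` — the shape of the field `InitialThetaData.range_K_iff`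
with `K := IntermediateField.fixedField (E.galoisRepTorsion l).ker`. [claim: Mochizuki2012, status: disputed] -/
theorem range_algebraMap_fixedField_ker_iff (x : AlgebraicClosure F) :
    x ∈ Set.range (algebraMap (IntermediateField.fixedField (E.galoisRepTorsion (l : ℤ)).ker)
        (AlgebraicClosure F)) ↔
      ∀ σ : AlgebraicClosure F ≃ₐ[F] AlgebraicClosure F,
        FixesTorsion (Fbar := AlgebraicClosure F) E l σ → σ x = x := by
  have hrange : x ∈ Set.range (algebraMap (IntermediateField.fixedField (E.galoisRepTorsion (l : ℤ)).ker)
      (AlgebraicClosure F)) ↔ x ∈ IntermediateField.fixedField (E.galoisRepTorsion (l : ℤ)).ker := by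
    constructor
    · rintro ⟨y, rfl⟩
      exact y.2
    · intro hx
      exact ⟨⟨x, hx⟩, rfl⟩
  rw [hrange, IntermediateField.mem_fixedField_iff]
  constructor
  · intro h σ hσ
    exact h σ ((fixesTorsion_iff_mem_ker E l σ).mp hσ)
  · intro h σ hσ
    exact h σ ((fixesTorsion_iff_mem_ker E l σ).mpr hσ)

variable [hl : Fact l.Prime]

omit [NumberField F] in
/-- `Ker(ρ̄_{E,l})` is open in `G_F` (tree `isOpen_ker_galoisRepTorsion_holds`, Silverman *AEC* III.§7),
`l` prime. [cite: SilvermanAEC2009, III.§7 and Lemma X.4.3 (proof)] -/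
theorem isOpen_ker_galoisRepTorsion_prime :
    IsOpen (((E.galoisRepTorsion (l : ℤ)).ker : Subgroup (Field.absoluteGaloisGroup F)) :
      Set (Field.absoluteGaloisGroup F)) :=
  E.isOpen_ker_galoisRepTorsion_holds (n := (l : ℤ)) (by exact_mod_cast hl.out.ne_zero)

/-- **"`K` … the FINITE … extension of `F`"** (Def. 3.1 (c)): the fixed field of `Ker(ρ̄_{E,l})` is
finite over `F` (open kernel). [claim: Mochizuki2012, status: disputed] -/
theorem finiteDimensional_fixedField_ker :
    FiniteDimensional F (IntermediateField.fixedField (E.galoisRepTorsion (l : ℤ)).ker :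
      IntermediateField F (AlgebraicClosure F)) :=
  finiteDimensional_fixedField_of_isOpen _ (isOpen_ker_galoisRepTorsion_prime E l)

/-- Hence `K := F̄^{Ker ρ̄_{E,l}}` is a number field (a finite extension of the number field `F`), as the
signature `InitialThetaData F K Fbar E l P` requires. [claim: Mochizuki2012, status: disputed] -/
theorem numberField_fixedField_ker :
    NumberField (IntermediateField.fixedField (E.galoisRepTorsion (l : ℤ)).ker :
      IntermediateField F (AlgebraicClosure F)) := by
  haveI := finiteDimensional_fixedField_ker E l
  exact NumberField.of_module_finite F _

omit [E.IsElliptic] hl in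
/-- **"`K` … the finite GALOIS extension of `F`"** (Def. 3.1 (c)): the fixed field of the normal
subgroup `Ker(ρ̄_{E,l})` is Galois over `F`. [claim: Mochizuki2012, status: disputed] -/
theorem isGalois_fixedField_ker :
    IsGalois F (IntermediateField.fixedField (E.galoisRepTorsion (l : ℤ)).ker :
      IntermediateField F (AlgebraicClosure F)) := by
  haveI : IsGalois F (AlgebraicClosure F) := {}
  exact IsGalois.of_fixedField_normal_subgroup (hn := MonoidHom.normal_ker _) _

end TorsionField

end Literature.IUT.HodgeTheaters
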